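/-
Copyright (c) 2026. All rights reserved.
Released under Apache 2.0 license as described in the file LICENSE.
Authors: abc-iut cell, campaign-S prover seat abc-iut-S7.
-/
import Mathlib.LinearAlgebra.PiTensorProduct.Basis
import Literature.IUT.LogVolume.PadicModuleTopology
import Literature.IUT.LogVolume.TensorPacketRing
import Literature.IUT.LogVolume.TensorPacketLemmas
import Literature.IUT.LogVolume.PacketBases
import HarnessLib

/-!
# The intrinsic Haar log-volume on a tensor packet `V = ⊗_{ℚ_p} k_i` ([IUTchIV] Prop. 1.4 (i), second half)

Mochizuki, *Inter-universal Teichmüller theory IV*, RIMS manuscript (Apr. 2020), Prop. 1.4 (i), kurims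
p. 13: "… we obtain a notion of log-volume … defined on compact open subsets of such tensor products,
valued in `ℝ`, and normalized so that `μ^log((R_E)^∼) = 0`, `μ^log(p·(R_E)^∼) = −log(p)`, for any
nonempty set `E ⊆ I`."  Also Dupuy–Hilado, arXiv:2004.13228, §3.4/§3.6 ("the unique normalized log Haar
measure on the tensor product of fields `K_{v̲_0} ⊗ ⋯ ⊗ K_{v̲_r}`", normalised by the `ℚ_p`-dimension).

REAL CONSTRUCTION over the cell's tensor packet ring (`TensorPacketRing.lean`: `V = PacketAlgebra p k
= ⨂[ℚ_p] i, k i`, `R_I = integerPacket`, `(R_I)^∼ = normalizedPacket`) and the abstract volume files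
(`NormalizedHaar`/`LogVolume`): no decomposition into fields is used — `V` gets the module topology
(`PadicModuleTopology.lean`), and

* `exists_basisLattice_eq_integerPacket` — with integral bases of the factors (abc-iut-S5's `IntegralBases.lean`),
  **`R_I = ⊗_{ℤ_p} 𝒪_{k_i}` is the lattice of the tensor basis**, so `R_I ⊆ V` is a COMPACT OPEN subring: the integral structure `integerStructure`
  (scoped instances: module topology, Borel σ-algebra, `V` a locally compact second countable
  Hausdorff topological ring);
* `tensorLogVolume` — **Mochizuki's `μ^log` on `V`**: the Haar log-volume divided by `dim_{ℚ_p} V`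
  and normalised so that `μ^log((R_I)^∼) = 0` (`tensorLogVolume_normalizedPacket`), with
  `μ^log(p·A) = μ^log(A) − log p` (`tensorLogVolume_p_smul`), monotonicity, `μ^log(R_I) ≤ 0`, and
  invariance under the units `𝒪_{k_i}^×` acting through the `i`-th factor
  (`tensorLogVolume_iota_smul_of_norm_eq_one`).

INTRINSIC (decomposition-free) companion of `TensorPacketVolume.packetLogVolume ψ` (defined through a
datum `ψ : V ≃ₐ ∏ L_j`; the two agree by Haar uniqueness, whence `ψ`-independence). The scaling
`μ^log(ι_i(g)·A) = μ^log(A) − ord(g)·log p` (Dupuy–Hilado (3.7)) is in `TensorPacketScaling.lean`.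
Junk values: `μ^log` of a set of zero or infinite Haar measure uses `Real.log 0 = 0`; the normalising
constant `μ^log_{R_I}((R_I)^∼)` is honest exactly when `(R_I)^∼` is compact (= [IUTchIV] Prop. 1.1,
`p^{d_{I*}}·(R_I)^∼ ⊆ R_I`; see `isCompact_normalizedPacket_of`).
[cite: Mochizuki2012, IUTchIV Prop. 1.4 (i) p. 13] [cite: DupuyHilado2025, §3.4, §3.6]
Deliberately NOT here: any decomposition `⊗ k_i ≅ ∏ L_j`; Prop. 1.1/1.2; [IUTchIII] Cor. 3.12. -/

noncomputable section
open MeasureTheory Set Metric TopologicalSpace Module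
open scoped NNReal ENNReal Pointwise TensorProduct NormedField

namespace Literature.IUT.LogVolume

/-! ## The tensor packet `V` as a locally compact ring; `R_I` is compact open -/
section Packet

variable (p : ℕ) [Fact p.Prime]
variable {I : Type} [Fintype I] [DecidableEq I]
variable (k : I → Type) [∀ i, NontriviallyNormedField (k i)] [∀ i, NormedAlgebra ℚ_[p] (k i)]
  [∀ i, IsUltrametricDist (k i)] [∀ i, ProperSpace (k i)]

/-- `V = ⊗ k_i` is a finite-dimensional `ℚ_p`-vector space. [cite: Mochizuki2012, IUTchIV Prop. 1.2 p. 10] -/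
scoped instance moduleFinite_packetAlgebra : Module.Finite ℚ_[p] (PacketAlgebra p k) := by
  haveI : ∀ i, Module.Finite ℚ_[p] (k i) := fun i => finiteDimensional p (k i)
  infer_instance

omit [∀ i, IsUltrametricDist (k i)] [∀ i, ProperSpace (k i)] in
/-- **The topology of `V`**: the module topology of the finite-dimensional `ℚ_p`-vector space
`⊗_{ℚ_p} k_i` (a tensor product of normed fields has no norm of its own; this is the product topology
in any basis). Scoped instance. [cite: Mochizuki2012, IUTchIV Prop. 1.4 (i) p. 13] -/
scoped instance topologicalSpace_packet : TopologicalSpace (PacketAlgebra p k) :=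
  moduleTopology ℚ_[p] (PacketAlgebra p k)

omit [∀ i, IsUltrametricDist (k i)] [∀ i, ProperSpace (k i)] in
/-- `V` carries the module topology (by definition). [cite: Mochizuki2012, IUTchIV Prop. 1.4 (i) p. 13] -/
scoped instance isModuleTopology_packet : IsModuleTopology ℚ_[p] (PacketAlgebra p k) := ⟨rfl⟩
omit [∀ i, IsUltrametricDist (k i)] [∀ i, ProperSpace (k i)] in
/-- `V` is a topological additive group. [cite: Mochizuki2012, IUTchIV Prop. 1.4 (i) p. 13] -/
scoped instance isTopologicalAddGroup_packet : IsTopologicalAddGroup (PacketAlgebra p k) :=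
  PadicModule.isTopologicalAddGroup p _

/-- `V` is a topological ring (multiplication is `ℚ_p`-bilinear on a finite module).
[cite: Mochizuki2012, IUTchIV Prop. 1.4 (i) p. 13] -/
scoped instance isTopologicalRing_packet : IsTopologicalRing (PacketAlgebra p k) :=
  IsModuleTopology.isTopologicalRing ℚ_[p] _

/-- `V` is Hausdorff. [cite: Mochizuki2012, IUTchIV Prop. 1.4 (i) p. 13] -/
scoped instance t2Space_packet : T2Space (PacketAlgebra p k) := PadicModule.t2Space p _
/-- `V` is locally compact. [cite: Mochizuki2012, IUTchIV Prop. 1.4 (i) p. 13] -/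
scoped instance locallyCompactSpace_packet : LocallyCompactSpace (PacketAlgebra p k) :=
  PadicModule.locallyCompactSpace p _
/-- `V` is second countable. [cite: Mochizuki2012, IUTchIV Prop. 1.4 (i) p. 13] -/
scoped instance secondCountableTopology_packet : SecondCountableTopology (PacketAlgebra p k) :=
  PadicModule.secondCountableTopology p _

omit [∀ i, IsUltrametricDist (k i)] [∀ i, ProperSpace (k i)] in
/-- The Borel σ-algebra on `V` (scoped instance). [cite: Mochizuki2012, IUTchIV Prop. 1.4 (i) p. 13] -/
scoped instance measurableSpace_packet : MeasurableSpace (PacketAlgebra p k) := borel _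

omit [∀ i, IsUltrametricDist (k i)] [∀ i, ProperSpace (k i)] in
/-- `V` is a Borel space. [cite: Mochizuki2012, IUTchIV Prop. 1.4 (i) p. 13] -/
scoped instance borelSpace_packet : BorelSpace (PacketAlgebra p k) := ⟨rfl⟩

omit [∀ i, ProperSpace (k i)] in
/-- **`R_I` is the lattice of a tensor basis**: for integral bases of the `k_i` (a `ℤ_p`-basis `bZ_i` of
`𝒪_{k_i}` spanning the `ℚ_p`-basis `bQ_i`), the `ℤ_p`-lattice of the tensor basis `⊗_i bQ_i(κ_i)` is
exactly `R_I = integerPacket` — abc-iut-S5's identification `norm_repr_le_of_mem_integerPacket` /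
`mem_integerPacket_of_norm_repr_le` (`PacketBases.lean`) in the lattice language ("the tensor product is
over `ℤ_p`", [IUTchIV] Prop. 1.1 p. 9). Needs `I ≠ ∅`. [cite: Mochizuki2012, IUTchIV Prop. 1.1 p. 9] -/
theorem basisLattice_piTensorProduct_eq_integerPacket [Nonempty I] {κ : I → Type} [∀ i, Fintype (κ i)]
    (bZ : Π i, Basis (κ i) ℤ_[p] (Valued.integer (k i))) (bQ : Π i, Basis (κ i) ℚ_[p] (k i))
    (hb : ∀ i j, bQ i j = (bZ i j : k i)) :
    (PadicModule.basisLattice p (Basis.piTensorProduct bQ) : Set (PacketAlgebra p k)) = integerPacket p k := by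
  ext v
  rw [SetLike.mem_coe, PadicModule.mem_basisLattice, SetLike.mem_coe]
  exact ⟨fun h => mem_integerPacket_of_norm_repr_le bZ bQ hb h,
    fun hv J => norm_repr_le_of_mem_integerPacket bZ bQ hb hv J⟩

/-- `R_I` is the lattice of SOME basis of `V`. [cite: Mochizuki2012, IUTchIV Prop. 1.1 p. 9] -/
theorem exists_basisLattice_eq_integerPacket [Nonempty I] :
    ∃ (κ : Type) (_ : Fintype κ) (B : Basis κ ℚ_[p] (PacketAlgebra p k)),
      (PadicModule.basisLattice p B : Set (PacketAlgebra p k)) = integerPacket p k := by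
  choose n bZ bQ hb using fun i => exists_integralBasis (p := p) (k i)
  exact ⟨_, inferInstance, Basis.piTensorProduct bQ, basisLattice_piTensorProduct_eq_integerPacket p k bZ bQ hb⟩

/-- **`R_I ⊆ V` is open.** [cite: Mochizuki2012, IUTchIV Prop. 1.4 (i) p. 13] -/
theorem isOpen_integerPacket [Nonempty I] : IsOpen (integerPacket p k : Set (PacketAlgebra p k)) := by
  obtain ⟨κ, _, B, hB⟩ := exists_basisLattice_eq_integerPacket p k
  exact hB ▸ PadicModule.isOpen_basisLattice p B

/-- **`R_I ⊆ V` is compact.** [cite: Mochizuki2012, IUTchIV Prop. 1.4 (i) p. 13] -/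
theorem isCompact_integerPacket [Nonempty I] :
    IsCompact (integerPacket p k : Set (PacketAlgebra p k)) := by
  obtain ⟨κ, _, B, hB⟩ := exists_basisLattice_eq_integerPacket p k
  exact hB ▸ PadicModule.isCompact_basisLattice p B

/-- **The integral structure `R_I`** of the tensor packet: `R_I = ⊗_{ℤ_p} 𝒪_{k_i}` as a compact open
additive subgroup of `V` (Dupuy–Hilado's `O_{v⃗}` "free of rank `n` over `ℤ_p`", §2.4.5; Mochizuki's
`R_I`). [cite: Mochizuki2012, IUTchIV Prop. 1.4 (i) p. 13] -/
def integerStructure [Nonempty I] : IntegralStructure (PacketAlgebra p k) :=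
  ⟨⟨(integerPacket p k).toAddSubgroup, isOpen_integerPacket p k⟩, isCompact_integerPacket p k⟩

/-- Unfolding `integerStructure`. [cite: Mochizuki2012, IUTchIV Prop. 1.4 (i) p. 13] -/
@[simp] theorem coe_integerStructure [Nonempty I] :
    (integerStructure p k : Set (PacketAlgebra p k)) = integerPacket p k := rfl

/-- `(R_I)^∼ ⊇ R_I` is open (it contains the open subgroup `R_I`). [cite: Mochizuki2012, IUTchIV Prop. 1.4 (i) p. 13] -/
theorem isOpen_normalizedPacket [Nonempty I] :
    IsOpen (normalizedPacket p k : Set (PacketAlgebra p k)) := by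
  have hle : (integerPacket p k).toAddSubgroup ≤ (normalizedPacket p k).toAddSubgroup :=
    fun x hx => integerPacket_le_normalizedPacket p k hx
  exact AddSubgroup.isOpen_mono hle (isOpen_integerPacket p k)

/-- **Compactness of `(R_I)^∼` from an inclusion `δ·(R_I)^∼ ⊆ R_I`** with `δ ∈ V` a unit (e.g.
`δ = p^{d_{I*}}`, [IUTchIV] Prop. 1.1): then `(R_I)^∼ ⊆ δ⁻¹·R_I` is a closed subset of a compact set.
This is how Prop. 1.1 makes Mochizuki's normalisation `μ^log((R_I)^∼) = 0` meaningful.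
[cite: Mochizuki2012, IUTchIV Prop. 1.1 p. 9] -/
theorem isCompact_normalizedPacket_of [Nonempty I] {δ : PacketAlgebra p k} (hδ : IsUnit δ)
    (h : ∀ x ∈ normalizedPacket p k, δ * x ∈ integerPacket p k) :
    IsCompact (normalizedPacket p k : Set (PacketAlgebra p k)) := by
  obtain ⟨u, rfl⟩ := hδ
  have hsub : (normalizedPacket p k : Set (PacketAlgebra p k)) ⊆
      (fun x => (↑u⁻¹ : PacketAlgebra p k) * x) '' (integerPacket p k : Set (PacketAlgebra p k)) := by
    intro x hx
    exact ⟨↑u * x, h x hx, by simp [← mul_assoc]⟩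
  have hclosed : IsClosed (normalizedPacket p k : Set (PacketAlgebra p k)) := by
    have : IsClosed (((⟨(normalizedPacket p k).toAddSubgroup, isOpen_normalizedPacket p k⟩ :
        OpenAddSubgroup (PacketAlgebra p k)) : Set (PacketAlgebra p k))) := OpenAddSubgroup.isClosed _
    exact this
  exact ((isCompact_integerPacket p k).image (continuous_const_mul _)).of_isClosed_subset hclosed hsub

/-- **`dim_{ℚ_p} V > 0`**: `V = ⊗ k_i` is a nonzero vector space (`dim V = ∏_i [k_i : ℚ_p]`, Mathlib
`Basis.piTensorProduct`). [cite: Mochizuki2012, IUTchIV Prop. 1.2 p. 10] -/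
theorem finrank_packet_pos : 0 < finrank ℚ_[p] (PacketAlgebra p k) := by
  haveI : ∀ i, FiniteDimensional ℚ_[p] (k i) := fun i => finiteDimensional p (k i)
  let B : Basis (Π i, Fin (finrank ℚ_[p] (k i))) ℚ_[p] (PacketAlgebra p k) :=
    Basis.piTensorProduct fun i => Module.finBasis ℚ_[p] (k i)
  rw [Module.finrank_eq_card_basis B, Fintype.card_pi]
  exact Finset.prod_pos fun i _ => by rw [Fintype.card_fin]; exact Module.finrank_pos

/-- `V` is nontrivial. [cite: Mochizuki2012, IUTchIV Prop. 1.2 p. 10] -/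
scoped instance nontrivial_packet : Nontrivial (PacketAlgebra p k) :=
  Module.nontrivial_of_finrank_pos (R := ℚ_[p]) (finrank_packet_pos p k)

/-! ## Mochizuki's `μ^log` on `V` -/

variable [Nonempty I]

/-- **The log-volume `μ^log` on the tensor packet `V = ⊗_{ℚ_p} k_i`** ([IUTchIV] Prop. 1.4 (i)):
the Haar log-volume normalised by `dim_{ℚ_p} V` ("by dividing by the degree") and shifted so that
`μ^log((R_I)^∼) = 0`:  `μ^log(A) := (log μ_{R_I}(A) − log μ_{R_I}((R_I)^∼)) / dim_{ℚ_p} V`, where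
`μ_{R_I}` is the Haar measure with `μ_{R_I}(R_I) = 1`.  Meaningful on sets of positive finite measure;
the shift is the honest constant exactly when `(R_I)^∼` is compact (`isCompact_normalizedPacket_of`),
otherwise `Real.log`'s junk value `0` is used. [cite: Mochizuki2012, IUTchIV Prop. 1.4 (i) p. 13] -/
def tensorLogVolume (A : Set (PacketAlgebra p k)) : ℝ :=
  (integerStructure p k).normalizedLogVolume (finrank ℚ_[p] (PacketAlgebra p k)) A -
    (integerStructure p k).normalizedLogVolume (finrank ℚ_[p] (PacketAlgebra p k))
      (normalizedPacket p k : Set (PacketAlgebra p k))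

/-- **Normalisation `μ^log((R_I)^∼) = 0`.** [cite: Mochizuki2012, IUTchIV Prop. 1.4 (i) p. 13] -/
@[simp] theorem tensorLogVolume_normalizedPacket :
    tensorLogVolume p k (normalizedPacket p k : Set (PacketAlgebra p k)) = 0 :=
  sub_self _

/-- **`μ^log(R_I) ≤ 0 = μ^log((R_I)^∼)`** when `(R_I)^∼` is compact ("by assertion (i), we have
`μ^log(R_I) ≤ μ^log((R_I)^∼) = 0`", proof of Prop. 1.4 (iii), p. 14).
[cite: Mochizuki2012, IUTchIV Prop. 1.4 (iii) proof p. 14] -/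
theorem tensorLogVolume_integerPacket_nonpos
    (hc : IsCompact (normalizedPacket p k : Set (PacketAlgebra p k))) :
    tensorLogVolume p k (integerPacket p k : Set (PacketAlgebra p k)) ≤ 0 := by
  have h0 : 0 < (integerStructure p k).haar (integerPacket p k : Set (PacketAlgebra p k)) := by
    rw [← coe_integerStructure]; exact (integerStructure p k).haar_pos_of_isOpen
      (integerStructure p k).isOpen (integerStructure p k).nonempty
  have hsub : (integerPacket p k : Set (PacketAlgebra p k)) ⊆ normalizedPacket p k :=
    fun x hx => integerPacket_le_normalizedPacket p k hx
  have := (integerStructure p k).normalizedLogVolume_mono (finrank ℚ_[p] (PacketAlgebra p k)) h0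
    ((integerStructure p k).haar_lt_top_of_isCompact hc) hsub
  unfold tensorLogVolume
  linarith

/-- **Monotonicity** on sets of positive finite volume. [cite: Mochizuki2012, IUTchIV Prop. 1.4 (i) p. 13] -/
theorem tensorLogVolume_mono {A B : Set (PacketAlgebra p k)} (hA : 0 < (integerStructure p k).haar A)
    (hB : (integerStructure p k).haar B < ∞) (h : A ⊆ B) :
    tensorLogVolume p k A ≤ tensorLogVolume p k B := by
  unfold tensorLogVolume
  have := (integerStructure p k).normalizedLogVolume_mono (finrank ℚ_[p] (PacketAlgebra p k)) hA hB h
  linarith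

/-- **Scaling under a continuous additive automorphism** `φ` of `V`:
`μ^log(φ(A)) = μ^log(A) + log μ_{R_I}(φ(R_I)) / dim` for `A` of positive finite volume.
[cite: Mochizuki2012, IUTchIV Prop. 1.4 (i) p. 13] -/
theorem tensorLogVolume_image (φ : PacketAlgebra p k ≃ₜ+ PacketAlgebra p k) {A : Set (PacketAlgebra p k)}
    (hA : 0 < (integerStructure p k).haar A) (hA' : (integerStructure p k).haar A < ∞) :
    tensorLogVolume p k (φ '' A) = tensorLogVolume p k A +
      (integerStructure p k).normalizedLogVolume (finrank ℚ_[p] (PacketAlgebra p k))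
        (φ '' (integerPacket p k : Set (PacketAlgebra p k))) := by
  unfold tensorLogVolume
  rw [(integerStructure p k).normalizedLogVolume_image _ φ hA hA', coe_integerStructure]
  ring

/-- The continuous additive automorphism "multiplication by a unit `u` of `V`". [cite: Mochizuki2012, IUTchIV Prop. 1.4 (i) p. 13] -/
def packetMulLeftEquiv (u : (PacketAlgebra p k)ˣ) : PacketAlgebra p k ≃ₜ+ PacketAlgebra p k :=
  { u.mulLeft with
    map_add' := fun x y => mul_add _ x y
    continuous_toFun := continuous_const_mul _
    continuous_invFun := continuous_const_mul _ }

omit [DecidableEq I] [Nonempty I] in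
/-- Unfolding `packetMulLeftEquiv`. [cite: Mochizuki2012, IUTchIV Prop. 1.4 (i) p. 13] -/
@[simp] theorem packetMulLeftEquiv_apply (u : (PacketAlgebra p k)ˣ) (x : PacketAlgebra p k) :
    packetMulLeftEquiv p k u x = ↑u * x := rfl

omit [DecidableEq I] [Nonempty I] in
/-- The image under `packetMulLeftEquiv u` is the translate `u • A`. [cite: Mochizuki2012, IUTchIV Prop. 1.4 (i) p. 13] -/
theorem packetMulLeftEquiv_image (u : (PacketAlgebra p k)ˣ) (A : Set (PacketAlgebra p k)) :
    packetMulLeftEquiv p k u '' A = u • A := by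
  ext x; simp [Set.mem_smul_set, Units.smul_def, eq_comm]

/-- **`μ^log(p·A) = μ^log(A) − log p`** for `A ⊆ V` of positive finite volume: multiplication by `p`
scales Haar measure on the `n`-dimensional `ℚ_p`-space `V` by `p^{−n}` (`distribHaarChar_p_smul`), and
`μ^log` divides by `n` ("normalized so that … `μ^log(p·(R_E)^∼) = −log(p)`").
[cite: Mochizuki2012, IUTchIV Prop. 1.4 (i) p. 13] -/
theorem tensorLogVolume_p_smul {A : Set (PacketAlgebra p k)} (hA : 0 < (integerStructure p k).haar A)
    (hA' : (integerStructure p k).haar A < ∞) :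
    tensorLogVolume p k ((p : ℚ_[p]) • A) = tensorLogVolume p k A - Real.log p := by
  let Λ := integerStructure p k
  set n := finrank ℚ_[p] (PacketAlgebra p k) with hn
  have hn0 : 0 < n := finrank_packet_pos p k
  -- `p` as a unit of `V`, and the associated automorphism
  have hpV : IsUnit (algebraMap ℚ_[p] (PacketAlgebra p k) p) :=
    (IsUnit.mk0 (p : ℚ_[p]) (Nat.cast_ne_zero.mpr (Fact.out : p.Prime).ne_zero)).map _
  obtain ⟨u, hu⟩ := hpV
  have himg : ∀ B : Set (PacketAlgebra p k), packetMulLeftEquiv p k u '' B = (p : ℚ_[p]) • B := fun B => by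
    rw [packetMulLeftEquiv_image]
    ext x
    simp only [Set.mem_smul_set, Units.smul_def, smul_eq_mul, hu, Algebra.smul_def]
  rw [← himg, tensorLogVolume_image p k _ hA hA']
  -- the modulus of `p`: `μ_Λ(p • R_I) = p^{-n} μ_Λ(R_I) = p^{-n}`
  have hmod : Λ.haar ((p : ℚ_[p]) • (integerPacket p k : Set (PacketAlgebra p k))) =
      ((p : ℝ≥0)⁻¹ ^ n : ℝ≥0) := by
    have h1 := distribHaarChar_mul (μ := Λ.haar)
      (Literature.NumberTheory.GaloisRepresentations.Ultrametric.PadicUniformizer.varpi p)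
      (integerPacket p k : Set (PacketAlgebra p k))
    rw [PadicModule.distribHaarChar_p_smul p (PacketAlgebra p k)] at h1
    have h2 : Λ.haar (integerPacket p k : Set (PacketAlgebra p k)) = 1 := by
      rw [← coe_integerStructure]; exact Λ.haar_self
    rw [h2, mul_one] at h1
    have h3 : (Literature.NumberTheory.GaloisRepresentations.Ultrametric.PadicUniformizer.varpi p) •
        (integerPacket p k : Set (PacketAlgebra p k)) = (p : ℚ_[p]) • (integerPacket p k : Set _) := by
      ext x
      simp only [Set.mem_smul_set, Units.smul_def,
        Literature.NumberTheory.GaloisRepresentations.Ultrametric.PadicUniformizer.varpi_val]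
    rw [← h3, ← h1, hn]
  rw [himg, IntegralStructure.normalizedLogVolume, IntegralStructure.logVolume, hmod]
  have hp : (0 : ℝ) < p := by exact_mod_cast (Fact.out : p.Prime).pos
  rw [ENNReal.coe_toReal, NNReal.coe_pow, NNReal.coe_inv, NNReal.coe_natCast, Real.log_pow,
    Real.log_inv, ← hn]
  field_simp
  ring

omit [Fintype I] [∀ i, IsUltrametricDist (k i)] [∀ i, ProperSpace (k i)] [Nonempty I] in
/-- For `u ∈ 𝒪_{k_i}^×` (‖u‖ = 1) acting through the `i`-th factor, `ι_i(u)·R_I = R_I`.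
[cite: Mochizuki2012, IUTchIV Prop. 1.4 (i) p. 13] -/
theorem iota_mul_integerPacket_of_norm_eq_one (i : I) {u : k i} (hu : ‖u‖ = 1) :
    (fun x => iota p k i u * x) '' (integerPacket p k : Set (PacketAlgebra p k)) = integerPacket p k := by
  have hmem : ∀ w : k i, ‖w‖ ≤ 1 → iota p k i w ∈ integerPacket p k := fun w hw => by
    refine Subring.subset_closure ⟨Pi.mulSingle i w, fun j => ?_, ?_⟩
    · rcases eq_or_ne j i with rfl | hne
      · rwa [Pi.mulSingle_eq_same]
      · rw [Pi.mulSingle_eq_of_ne hne, norm_one]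
    · simp [iota, purePacket, PiTensorProduct.singleAlgHom_apply, MonoidHom.mulSingle_apply]
  have hu0 : u ≠ 0 := norm_pos_iff.mp (by rw [hu]; exact one_pos)
  apply Set.Subset.antisymm
  · rintro _ ⟨x, hx, rfl⟩
    exact Subring.mul_mem _ (hmem u hu.le) hx
  · intro x hx
    refine ⟨iota p k i u⁻¹ * x, Subring.mul_mem _ (hmem u⁻¹ (by rw [norm_inv, hu, inv_one])) hx, ?_⟩
    simp only
    rw [← mul_assoc, ← map_mul, mul_inv_cancel₀ hu0, map_one, one_mul]

/-- **Units of `𝒪_{k_i}` preserve `μ^log`**: for `‖u‖ = 1`, `μ^log(ι_i(u)·A) = μ^log(A)` ("if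
`x ∈ O_k^×`, then `μ^log_k(x·A) = μ^log_k(A)`", [AbsTopIII] Prop. 5.7 (i)(b), for the packet).
[cite: Mochizuki2012, IUTchIV Prop. 1.4 (i) p. 13] -/
theorem tensorLogVolume_iota_smul_of_norm_eq_one (i : I) {u : k i} (hu : ‖u‖ = 1)
    (A : Set (PacketAlgebra p k)) :
    tensorLogVolume p k ((fun x => iota p k i u * x) '' A) = tensorLogVolume p k A := by
  have hu0 : u ≠ 0 := norm_pos_iff.mp (by rw [hu]; exact one_pos)
  obtain ⟨w, hw⟩ := ((IsUnit.mk0 u hu0).map (iota p k i))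
  have himg : ∀ B : Set (PacketAlgebra p k), packetMulLeftEquiv p k w '' B = (fun x => iota p k i u * x) '' B :=
    fun B => by rw [packetMulLeftEquiv_image]; ext x; simp [Set.mem_smul_set, Units.smul_def, hw, eq_comm]
  have hfix : packetMulLeftEquiv p k w '' (integerStructure p k : Set (PacketAlgebra p k)) =
      (integerStructure p k : Set (PacketAlgebra p k)) := by
    rw [coe_integerStructure, himg, iota_mul_integerPacket_of_norm_eq_one p k i hu]
  unfold tensorLogVolume IntegralStructure.normalizedLogVolume
  rw [← himg, (integerStructure p k).logVolume_image_of_image_eq _ hfix]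

end Packet

end Literature.IUT.LogVolume

end
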